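import Literature.NumberTheory.Rogawski1990.AdelicStableOrbitalEulerDischargeCanonical
import Literature.NumberTheory.Automorphic.OrbitalMeasureFamilyTransport
import Literature.NumberTheory.Automorphic.AdelicRegularOrbitClosed
import HarnessLib

/-!
# (xii-d) AT THE TRANSPORT FAMILY `mq v := (ψ_v)_* mG v`: every arithmetic AND analytic hypothesis of ★ (E3c)
# `MatchingAdeleG.exists_isEulerOnClasses_ofLocalAdelic` discharged
(Rogawski (1990), §4.3 pp. 43–44, §4.9 p. 54, §5.4 (5.4.3) pp. 72–73, §14.2 (14.2.1) p. 232; Kottwitz (1986) Prop. 7.1; Gelbart (1975) §10)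

Topic `NumberTheory/Rogawski1990`; namespace `Literature.NumberTheory.Rogawski1990`.  THEOREMS ONLY: no definition, no named fact, no instance,
no `sorry`.  Cell `pub/hodgecm-mathlib`, ENGINE T1 (crux item stmt-HodgeConjecture-24833), F0P3a row (E3t) (GO #88 (a)): what ED 1.19c's per-pin
lemma `IsPinned.sjG_isEulerOnClasses` reads in ONE `exact`.

★ (E3c) proves the Σ–Π exchange `IsEulerOnClasses 𝒞_𝐀(γ₀) (ofLocalAdelic mq mqi) T.eval S …` for ANY local families `mq v` on the quasi-split group
`G = U(Φ₃)` under: the [Kt₄]-7.1 fact, admissibility of `mq v` on the regular classes, the two normalisations `hnormγ` ∕ `hnorm`, and the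
integrability `hFi` of the orbital integrands at the classes of `𝒞_𝐀(γ₀)`.  Here `mq` is the kit's DERIVED family — the transport of the inner
form's families along the local congruences, `mq v := (mG v).transport (ψ v).toMulEquiv (ψ v).continuous (ψ v).symm.continuous`
(SPEC-ed1.19 §2 (mq)) — and ALL of those hypotheses are discharged from data and pins that the kit carries:

* the fact: ★ `MatchingAdeleGEventuallyKConj_holds` (F0P3a-p03);
* admissibility: `mG v` canonical ⇒ admissible (★ `IsCanonical.isAdmissibleOn`) ⇒ `ψ_* mG v` admissible (★ F1 `forall_isAdmissibleOn_isRegularElt_transport`);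
* `hnormγ` ∕ `hnorm`: ★ (MQ) `UnitaryGroup.exists_isNormalisedOff_transport_toAdelic` ∕ `UnitaryGroup.forall_exists_isNormalisedOff_transport_matchingAdeleG`
  (canonicity of `mq v` for the normalised `νq v` holds OFF the level-matching set `S₀` only — which is all `IsNormalisedOff` reads), with ★
  `compactCoreCentralizerLevelAE_of_hermitian` at `Φ₃` (as in ★ E3d);
* `hFi`: ★ `MatchingAdeleG.integrable_descConj_out_of_mem_classes` (regular adelic classes are CLOSED, F0P3a-p03) for the measure `ofLocalAdelic mq mqi c`,
  which is finite on compacta by ★ Q4-C3 `OrbitalMeasureFamily.ofLocalAdelic_admissible` — its normalisation input at `out c` is again (MQ) (`out c`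
  is the adèle of a matching adèle, ★ `MatchingAdeleG.mem_classes_iff_forall`), its admissibility inputs are the regularity of `(out c)_v ↔ (γ₀)_v`
  and of `(out c)_∞ ↔ γ₀ ⊗ 1` (★ `corresponds_toLocal_toAdelic`, ★ `corresponds_cmRationalToArch`, ★ `isRegularElt_of_isConj`).

* §1 **`MatchingAdeleG.integrable_descConj_ofLocalAdelic_of_mem_classes`** — the `hFi` of ★ (E3c) for ANY `mq` admissible on the regular
  classes, `mqi` admissible, `mq` normalised off a finite set at every matching adèle (generic in `mq`; its own budget of heartbeats);
* §2 `transport_isAdmissibleOn_isRegularElt_of_eq` — admissibility of an opaque `mq = ψ_* mG` (★ F1 moved along `hmq`);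
* §3 **`MatchingAdeleG.exists_isEulerOnClasses_transport_of_eq`** — binders `(mG) (ψ) (hcorr') (S₀) (hψK) (νG) (νq) (hK) (hKq) (hcan) (mq) (hmq : ∀ v,
  mq v = (mG v).transport …) (mqi) (hadmA) {γ₀} (hreg) {γ} (hγ) (T) (hT)`; conclusion = ★ (E3c)'s verbatim at `mq` (the kit reads it with
  `mq := 𝔨.mq`, `hmq := fun _ => rfl` — no kit-sized family term is unfolded);
* **`MatchingAdeleG.exists_isEulerOnClasses_transport`** — the same without `(mq) (hmq)`, conclusion at the literal family
  `fun v => (mG v).transport (ψ v).toMulEquiv (ψ v).continuous (ψ v).symm.continuous`.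
What remains as hypotheses is exactly the kit's currency: the inner form's canonical local families `mG` for Haar measures `νG v` with
`νG v (U(H)(𝒪_v)) = 1` (guard `hK`, pin `canonical`), the local congruences `ψ_v` class-preserving backwards and level matching off `S₀` (pin (Ψ⁺)),
ONE normalised Haar measure `νq v` on `U(Φ₃)(L⁺_v)` (★ `exists_isHaarMeasure_cmLocalIntegralLevel_eq_one`), and the archimedean family `mqi`
admissible on the regular classes (pin (ix′)).  HC_CM is proved only modulo the printed citations until rung 0 closes; this file is unconditional.

## References
* [Rogawski1990] J. D. Rogawski, *Automorphic Representations of Unitary Groups in Three Variables*, Ann. of Math. Stud. 123 (1990), §4.3 pp. 43–44,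
  §4.9 p. 54, §5.4 (5.4.3) pp. 72–73, §14.2 (14.2.1) p. 232.
* [Kottwitz1986] R. E. Kottwitz, *Stable trace formula: elliptic singular terms*, Math. Ann. 275 (1986), Prop. 7.1.
* [Gelbart1975] S. Gelbart, *Automorphic forms on adele groups*, Ann. of Math. Stud. 83 (1975), §10 pp. 154–155.
-/

set_option autoImplicit false

noncomputable section

open NumberField IsDedekindDomain Filter Function MeasureTheory
open scoped MatrixGroups

namespace Literature.NumberTheory.Rogawski1990

open Literature.NumberTheory.Automorphic Literature.MeasureTheory.Group

section Transport

variable {L : Type} [Field L] [NumberField L] [IsCMField L] {H : Matrix (Fin 3) (Fin 3) L}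
  -- Borel structures: the adelic orbit quotients of `U(Φ₃)`, the local groups of `U(Φ₃)` and their orbit quotients, the archimedean orbit quotients
  [∀ g : (UnitaryGroup.cmDatum L 3 (Matrix.of fun i j : Fin 3 => if i.val + j.val + 1 = 3 then (1 : L) else 0)).Adelic,
    MeasurableSpace ((UnitaryGroup.cmDatum L 3 (Matrix.of fun i j : Fin 3 => if i.val + j.val + 1 = 3 then (1 : L) else 0)).Adelic ⧸
      Subgroup.centralizer ({g} : Set (UnitaryGroup.cmDatum L 3 (Matrix.of fun i j : Fin 3 => if i.val + j.val + 1 = 3 then (1 : L) else 0)).Adelic))]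
  [∀ g : (UnitaryGroup.cmDatum L 3 (Matrix.of fun i j : Fin 3 => if i.val + j.val + 1 = 3 then (1 : L) else 0)).Adelic,
    BorelSpace ((UnitaryGroup.cmDatum L 3 (Matrix.of fun i j : Fin 3 => if i.val + j.val + 1 = 3 then (1 : L) else 0)).Adelic ⧸
      Subgroup.centralizer ({g} : Set (UnitaryGroup.cmDatum L 3 (Matrix.of fun i j : Fin 3 => if i.val + j.val + 1 = 3 then (1 : L) else 0)).Adelic))]
  [∀ v : HeightOneSpectrum (𝓞 ↥(maximalRealSubfield L)),
    MeasurableSpace ((UnitaryGroup.cmDatum L 3 (Matrix.of fun i j : Fin 3 => if i.val + j.val + 1 = 3 then (1 : L) else 0)).Local v)]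
  [∀ v : HeightOneSpectrum (𝓞 ↥(maximalRealSubfield L)),
    BorelSpace ((UnitaryGroup.cmDatum L 3 (Matrix.of fun i j : Fin 3 => if i.val + j.val + 1 = 3 then (1 : L) else 0)).Local v)]
  [∀ (v : HeightOneSpectrum (𝓞 ↥(maximalRealSubfield L)))
    (x : (UnitaryGroup.cmDatum L 3 (Matrix.of fun i j : Fin 3 => if i.val + j.val + 1 = 3 then (1 : L) else 0)).Local v),
    MeasurableSpace ((UnitaryGroup.cmDatum L 3 (Matrix.of fun i j : Fin 3 => if i.val + j.val + 1 = 3 then (1 : L) else 0)).Local v ⧸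
      Subgroup.centralizer ({x} : Set ((UnitaryGroup.cmDatum L 3 (Matrix.of fun i j : Fin 3 => if i.val + j.val + 1 = 3 then (1 : L) else 0)).Local v)))]
  [∀ (v : HeightOneSpectrum (𝓞 ↥(maximalRealSubfield L)))
    (x : (UnitaryGroup.cmDatum L 3 (Matrix.of fun i j : Fin 3 => if i.val + j.val + 1 = 3 then (1 : L) else 0)).Local v),
    BorelSpace ((UnitaryGroup.cmDatum L 3 (Matrix.of fun i j : Fin 3 => if i.val + j.val + 1 = 3 then (1 : L) else 0)).Local v ⧸
      Subgroup.centralizer ({x} : Set ((UnitaryGroup.cmDatum L 3 (Matrix.of fun i j : Fin 3 => if i.val + j.val + 1 = 3 then (1 : L) else 0)).Local v)))]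
  [∀ a : UnitaryGroup.arch (↥(maximalRealSubfield L)) L (IsCMField.complexConj L) 3 (Matrix.of fun i j : Fin 3 => if i.val + j.val + 1 = 3 then (1 : L) else 0),
    MeasurableSpace (UnitaryGroup.arch (↥(maximalRealSubfield L)) L (IsCMField.complexConj L) 3 (Matrix.of fun i j : Fin 3 => if i.val + j.val + 1 = 3 then (1 : L) else 0) ⧸
      Subgroup.centralizer ({a} : Set (UnitaryGroup.arch (↥(maximalRealSubfield L)) L (IsCMField.complexConj L) 3
        (Matrix.of fun i j : Fin 3 => if i.val + j.val + 1 = 3 then (1 : L) else 0))))]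
  [∀ a : UnitaryGroup.arch (↥(maximalRealSubfield L)) L (IsCMField.complexConj L) 3 (Matrix.of fun i j : Fin 3 => if i.val + j.val + 1 = 3 then (1 : L) else 0),
    BorelSpace (UnitaryGroup.arch (↥(maximalRealSubfield L)) L (IsCMField.complexConj L) 3 (Matrix.of fun i j : Fin 3 => if i.val + j.val + 1 = 3 then (1 : L) else 0) ⧸
      Subgroup.centralizer ({a} : Set (UnitaryGroup.arch (↥(maximalRealSubfield L)) L (IsCMField.complexConj L) 3
        (Matrix.of fun i j : Fin 3 => if i.val + j.val + 1 = 3 then (1 : L) else 0))))]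
  -- Borel structures on the inner form's side: the local groups of `U(H)` and their orbit quotients
  [∀ v : HeightOneSpectrum (𝓞 ↥(maximalRealSubfield L)), MeasurableSpace ((UnitaryGroup.cmDatum L 3 H).Local v)]
  [∀ v : HeightOneSpectrum (𝓞 ↥(maximalRealSubfield L)), BorelSpace ((UnitaryGroup.cmDatum L 3 H).Local v)]
  [∀ (v : HeightOneSpectrum (𝓞 ↥(maximalRealSubfield L))) (x : (UnitaryGroup.cmDatum L 3 H).Local v),
    MeasurableSpace ((UnitaryGroup.cmDatum L 3 H).Local v ⧸ Subgroup.centralizer ({x} : Set ((UnitaryGroup.cmDatum L 3 H).Local v)))]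
  [∀ (v : HeightOneSpectrum (𝓞 ↥(maximalRealSubfield L))) (x : (UnitaryGroup.cmDatum L 3 H).Local v),
    BorelSpace ((UnitaryGroup.cmDatum L 3 H).Local v ⧸ Subgroup.centralizer ({x} : Set ((UnitaryGroup.cmDatum L 3 H).Local v)))]

/-! ### §1 `hFi` for ANY admissible, normalised local families (generic in `mq`; the integrability input of ★ E3c) -/

omit
  [∀ v : HeightOneSpectrum (𝓞 ↥(maximalRealSubfield L)),
    MeasurableSpace ((UnitaryGroup.cmDatum L 3 (Matrix.of fun i j : Fin 3 => if i.val + j.val + 1 = 3 then (1 : L) else 0)).Local v)]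
  [∀ v : HeightOneSpectrum (𝓞 ↥(maximalRealSubfield L)),
    BorelSpace ((UnitaryGroup.cmDatum L 3 (Matrix.of fun i j : Fin 3 => if i.val + j.val + 1 = 3 then (1 : L) else 0)).Local v)]
  [∀ v : HeightOneSpectrum (𝓞 ↥(maximalRealSubfield L)), MeasurableSpace ((UnitaryGroup.cmDatum L 3 H).Local v)]
  [∀ v : HeightOneSpectrum (𝓞 ↥(maximalRealSubfield L)), BorelSpace ((UnitaryGroup.cmDatum L 3 H).Local v)]
  [∀ (v : HeightOneSpectrum (𝓞 ↥(maximalRealSubfield L))) (x : (UnitaryGroup.cmDatum L 3 H).Local v),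
    MeasurableSpace ((UnitaryGroup.cmDatum L 3 H).Local v ⧸ Subgroup.centralizer ({x} : Set ((UnitaryGroup.cmDatum L 3 H).Local v)))]
  [∀ (v : HeightOneSpectrum (𝓞 ↥(maximalRealSubfield L))) (x : (UnitaryGroup.cmDatum L 3 H).Local v),
    BorelSpace ((UnitaryGroup.cmDatum L 3 H).Local v ⧸ Subgroup.centralizer ({x} : Set ((UnitaryGroup.cmDatum L 3 H).Local v)))] in
/-- **The orbital integrand of an `IsTest` pure tensor is integrable at every class of `𝒞_𝐀(γ₀)` for `ofLocalAdelic mq mqi`** as soon as the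
local families `mq v` are admissible on the regular classes, `mqi` is admissible on the regular archimedean classes, and `mq` is normalised off a
finite set at every matching adèle: `out c` is the adèle of a matching adèle (★ `MatchingAdeleG.mem_classes_iff_forall`), so `ofLocalAdelic mq mqi c`
is finite on compacta (★ `OrbitalMeasureFamily.ofLocalAdelic_admissible`, regularity of `(out c)_v ↔ (γ₀)_v` and `(out c)_∞ ↔ γ₀ ⊗ 1`), and regular
adelic classes are CLOSED (★ `MatchingAdeleG.integrable_descConj_out_of_mem_classes`).  This is the hypothesis `hFi` of ★ (E3c), for every `mq`.
[cite: Rogawski1990, §4.9 p. 54; §5.4 (5.4.3) p. 72] [cite: Kottwitz1986, Prop. 7.1] -/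
theorem MatchingAdeleG.integrable_descConj_ofLocalAdelic_of_mem_classes
    {γ₀ : (UnitaryGroup.cmDatum L 3 H).Rational} (hreg : IsRegularElt (γ₀.val : GL (Fin 3) L))
    {γ : (UnitaryGroup.cmDatum L 3 (Matrix.of fun i j : Fin 3 => if i.val + j.val + 1 = 3 then (1 : L) else 0)).Rational}
    (hγ : Corresponds (cmConjRingHom L) H (Matrix.of fun i j : Fin 3 => if i.val + j.val + 1 = 3 then (1 : L) else 0) γ₀ γ)
    (mq : ∀ v : HeightOneSpectrum (𝓞 ↥(maximalRealSubfield L)), OrbitalMeasureFamily ((UnitaryGroup.cmDatum L 3 (Matrix.of fun i j : Fin 3 => if i.val + j.val + 1 = 3 then (1 : L) else 0)).Local v))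
    (mqi : OrbitalMeasureFamily (UnitaryGroup.arch (↥(maximalRealSubfield L)) L (IsCMField.complexConj L) 3 (Matrix.of fun i j : Fin 3 => if i.val + j.val + 1 = 3 then (1 : L) else 0)))
    (hadm : ∀ v, (mq v).IsAdmissibleOn fun x => IsRegularElt (x.val : GL (Fin 3) (UnitaryGroup.LocalRing L v)))
    (hadmA : mqi.IsAdmissibleOn fun a => IsRegularElt (a.val : GL (Fin 3) (mixedEmbedding.mixedSpace L)))
    (hnorm : ∀ p : MatchingAdeleG L H γ₀, ∃ S₀ : Finset (HeightOneSpectrum (𝓞 ↥(maximalRealSubfield L))),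
      UnitaryGroup.IsNormalisedOff L 3 (Matrix.of fun i j : Fin 3 => if i.val + j.val + 1 = 3 then (1 : L) else 0) mq p.adele S₀)
    (T : UnitaryGroup.PureTensor L 3 (Matrix.of fun i j : Fin 3 => if i.val + j.val + 1 = 3 then (1 : L) else 0)) (hT : T.IsTest)
    (c : ConjClasses (UnitaryGroup.cmDatum L 3 (Matrix.of fun i j : Fin 3 => if i.val + j.val + 1 = 3 then (1 : L) else 0)).Adelic) (hc : c ∈ MatchingAdeleG.classes L H γ₀) :
    Integrable
      (descConj (Quotient.out c : (UnitaryGroup.cmDatum L 3 (Matrix.of fun i j : Fin 3 => if i.val + j.val + 1 = 3 then (1 : L) else 0)).Adelic)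
        (Subgroup.centralizer ({(Quotient.out c : (UnitaryGroup.cmDatum L 3 (Matrix.of fun i j : Fin 3 => if i.val + j.val + 1 = 3 then (1 : L) else 0)).Adelic)} : Set (UnitaryGroup.cmDatum L 3 (Matrix.of fun i j : Fin 3 => if i.val + j.val + 1 = 3 then (1 : L) else 0)).Adelic))
        (centralizer_comm _) T.eval)
      (UnitaryGroup.OrbitalMeasureFamily.ofLocalAdelic L 3 (Matrix.of fun i j : Fin 3 => if i.val + j.val + 1 = 3 then (1 : L) else 0) mq mqi c) := by
  -- regularity bookkeeping (as in ★ E3c)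
  have hγreg : IsRegularElt (γ.val : GL (Fin 3) L) := isRegularElt_of_isConj hγ hreg
  have hγv : ∀ v : HeightOneSpectrum (𝓞 ↥(maximalRealSubfield L)),
      IsRegularElt (((UnitaryGroup.cmDatum L 3 (Matrix.of fun i j : Fin 3 => if i.val + j.val + 1 = 3 then (1 : L) else 0)).toLocal v
        ((UnitaryGroup.cmDatum L 3 (Matrix.of fun i j : Fin 3 => if i.val + j.val + 1 = 3 then (1 : L) else 0)).toAdelic γ)).val :
          GL (Fin 3) (UnitaryGroup.LocalRing L v)) := fun v =>
    (hγreg.map (algebraMap L (AdeleRing (𝓞 L) L))).map (UnitaryGroup.adeleToLocal L v)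
  have hregcorr : ∀ v (x : (UnitaryGroup.cmDatum L 3 (Matrix.of fun i j : Fin 3 => if i.val + j.val + 1 = 3 then (1 : L) else 0)).Local v),
      Corresponds (UnitaryGroup.conjLocal L (IsCMField.complexConj L) v)
        ((UnitaryGroup.adelicForm L 3 H).map (UnitaryGroup.adeleToLocal L v))
        ((UnitaryGroup.adelicForm L 3 (Matrix.of fun i j : Fin 3 => if i.val + j.val + 1 = 3 then (1 : L) else 0)).map (UnitaryGroup.adeleToLocal L v))
        ((UnitaryGroup.cmDatum L 3 H).toLocal v ((UnitaryGroup.cmDatum L 3 H).toAdelic γ₀)) x →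
      IsRegularElt (x.val : GL (Fin 3) (UnitaryGroup.LocalRing L v)) := fun v x hx =>
    isRegularElt_of_isConj ((corresponds_toLocal_toAdelic hγ v).isStablyConj_right hx) (hγv v)
  have hregout : ∀ v (x : (UnitaryGroup.cmDatum L 3 (Matrix.of fun i j : Fin 3 => if i.val + j.val + 1 = 3 then (1 : L) else 0)).Local v),
      IsRegularElt (x.val : GL (Fin 3) (UnitaryGroup.LocalRing L v)) →
      IsRegularElt ((Quotient.out (ConjClasses.mk x) :
        (UnitaryGroup.cmDatum L 3 (Matrix.of fun i j : Fin 3 => if i.val + j.val + 1 = 3 then (1 : L) else 0)).Local v).val :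
          GL (Fin 3) (UnitaryGroup.LocalRing L v)) := fun v x hx =>
    isRegularElt_of_isConj ((UnitaryGroup.«local» L (IsCMField.complexConj L) 3
      (Matrix.of fun i j : Fin 3 => if i.val + j.val + 1 = 3 then (1 : L) else 0) v).subtype.map_isConj (isConj_out_conjClasses_mk x)) hx
  -- `out c` is the adèle of a matching adèle `q`
  obtain ⟨q, hq⟩ := (MatchingAdeleG.mem_classes_iff_forall.1 hc).1 (Quotient.out c) (Quotient.out_eq c)
  obtain ⟨S₁, hS₁⟩ := hnorm q
  rw [hq] at hS₁
  obtain ⟨-, hfin, -⟩ := UnitaryGroup.OrbitalMeasureFamily.ofLocalAdelic_admissible L 3 _ mq mqi c hS₁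
    (fun v => hadm v _ (hregout v _ (hregcorr v _ (by rw [← hq]; exact q.corresponds_toLocal v))))
    (hadmA _ (isRegularElt_of_isConj
      ((UnitaryGroup.arch (↥(maximalRealSubfield L)) L (IsCMField.complexConj L) 3
        (Matrix.of fun i j : Fin 3 => if i.val + j.val + 1 = 3 then (1 : L) else 0)).subtype.map_isConj (isConj_out_conjClasses_mk _))
      (isRegularElt_of_isConj ((corresponds_cmRationalToArch hγ).isStablyConj_right (by rw [← hq]; exact q.corresponds_arch))
        (hγreg.map (mixedEmbedding L)))))
  haveI := hfin
  exact MatchingAdeleG.integrable_descConj_out_of_mem_classes L H hreg hγ c hc _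
    (T.continuous_eval hT.isUnramified hT.isArchTest.continuous_arch
      (fun v _ => UnitaryGroup.PureTensor.continuous_loc hT.isUnramified hT.isFinSmooth v))
    (T.hasCompactSupport_eval hT.isUnramified hT.isArchTest.hasCompactSupport_arch
      (fun v _ => UnitaryGroup.PureTensor.hasCompactSupport_loc hT.isUnramified hT.isFinSmooth v)) _

/-! ### §2 The transport family: admissibility and the two normalisations moved onto an opaque `mq = (ψ_v)_* mG v` -/

omit
  [∀ g : (UnitaryGroup.cmDatum L 3 (Matrix.of fun i j : Fin 3 => if i.val + j.val + 1 = 3 then (1 : L) else 0)).Adelic,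
    MeasurableSpace ((UnitaryGroup.cmDatum L 3 (Matrix.of fun i j : Fin 3 => if i.val + j.val + 1 = 3 then (1 : L) else 0)).Adelic ⧸
      Subgroup.centralizer ({g} : Set (UnitaryGroup.cmDatum L 3 (Matrix.of fun i j : Fin 3 => if i.val + j.val + 1 = 3 then (1 : L) else 0)).Adelic))]
  [∀ g : (UnitaryGroup.cmDatum L 3 (Matrix.of fun i j : Fin 3 => if i.val + j.val + 1 = 3 then (1 : L) else 0)).Adelic,
    BorelSpace ((UnitaryGroup.cmDatum L 3 (Matrix.of fun i j : Fin 3 => if i.val + j.val + 1 = 3 then (1 : L) else 0)).Adelic ⧸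
      Subgroup.centralizer ({g} : Set (UnitaryGroup.cmDatum L 3 (Matrix.of fun i j : Fin 3 => if i.val + j.val + 1 = 3 then (1 : L) else 0)).Adelic))]
  [∀ v : HeightOneSpectrum (𝓞 ↥(maximalRealSubfield L)),
    MeasurableSpace ((UnitaryGroup.cmDatum L 3 (Matrix.of fun i j : Fin 3 => if i.val + j.val + 1 = 3 then (1 : L) else 0)).Local v)]
  [∀ v : HeightOneSpectrum (𝓞 ↥(maximalRealSubfield L)),
    BorelSpace ((UnitaryGroup.cmDatum L 3 (Matrix.of fun i j : Fin 3 => if i.val + j.val + 1 = 3 then (1 : L) else 0)).Local v)]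
  [∀ a : UnitaryGroup.arch (↥(maximalRealSubfield L)) L (IsCMField.complexConj L) 3 (Matrix.of fun i j : Fin 3 => if i.val + j.val + 1 = 3 then (1 : L) else 0),
    MeasurableSpace (UnitaryGroup.arch (↥(maximalRealSubfield L)) L (IsCMField.complexConj L) 3 (Matrix.of fun i j : Fin 3 => if i.val + j.val + 1 = 3 then (1 : L) else 0) ⧸
      Subgroup.centralizer ({a} : Set (UnitaryGroup.arch (↥(maximalRealSubfield L)) L (IsCMField.complexConj L) 3
        (Matrix.of fun i j : Fin 3 => if i.val + j.val + 1 = 3 then (1 : L) else 0))))]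
  [∀ a : UnitaryGroup.arch (↥(maximalRealSubfield L)) L (IsCMField.complexConj L) 3 (Matrix.of fun i j : Fin 3 => if i.val + j.val + 1 = 3 then (1 : L) else 0),
    BorelSpace (UnitaryGroup.arch (↥(maximalRealSubfield L)) L (IsCMField.complexConj L) 3 (Matrix.of fun i j : Fin 3 => if i.val + j.val + 1 = 3 then (1 : L) else 0) ⧸
      Subgroup.centralizer ({a} : Set (UnitaryGroup.arch (↥(maximalRealSubfield L)) L (IsCMField.complexConj L) 3
        (Matrix.of fun i j : Fin 3 => if i.val + j.val + 1 = 3 then (1 : L) else 0))))] in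
/-- `mq = ψ_* mG` is admissible on the regular classes (★ F1 `forall_isAdmissibleOn_isRegularElt_transport` over ★ `IsCanonical.isAdmissibleOn`).
[cite: Rogawski1990, §14.2 (14.2.1) p. 232] -/
theorem transport_isAdmissibleOn_isRegularElt_of_eq
    (mG : ∀ v : HeightOneSpectrum (𝓞 ↥(maximalRealSubfield L)), OrbitalMeasureFamily ((UnitaryGroup.cmDatum L 3 H).Local v))
    (ψ : ∀ v : HeightOneSpectrum (𝓞 ↥(maximalRealSubfield L)), (UnitaryGroup.cmDatum L 3 H).Local v ≃ₜ* (UnitaryGroup.cmDatum L 3 (Matrix.of fun i j : Fin 3 => if i.val + j.val + 1 = 3 then (1 : L) else 0)).Local v)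
    (hcorr' : ∀ v (x : (UnitaryGroup.cmDatum L 3 (Matrix.of fun i j : Fin 3 => if i.val + j.val + 1 = 3 then (1 : L) else 0)).Local v),
      Corresponds (UnitaryGroup.conjLocal L (IsCMField.complexConj L) v) ((UnitaryGroup.adelicForm L 3 H).map (UnitaryGroup.adeleToLocal L v))
        ((UnitaryGroup.adelicForm L 3 (Matrix.of fun i j : Fin 3 => if i.val + j.val + 1 = 3 then (1 : L) else 0)).map (UnitaryGroup.adeleToLocal L v))
        ((ψ v).symm x) x)
    (νG : ∀ v : HeightOneSpectrum (𝓞 ↥(maximalRealSubfield L)), Measure ((UnitaryGroup.cmDatum L 3 H).Local v))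
    [∀ v, (νG v).IsHaarMeasure] [∀ v, (νG v).IsMulRightInvariant]
    (hcan : ∀ v, (mG v).IsCanonical (fun x => IsRegularElt (x.val : GL (Fin 3) (UnitaryGroup.LocalRing L v))) (νG v))
    (mq : ∀ v : HeightOneSpectrum (𝓞 ↥(maximalRealSubfield L)), OrbitalMeasureFamily ((UnitaryGroup.cmDatum L 3 (Matrix.of fun i j : Fin 3 => if i.val + j.val + 1 = 3 then (1 : L) else 0)).Local v))
    (hmq : ∀ v, mq v = (mG v).transport (ψ v).toMulEquiv (ψ v).continuous (ψ v).symm.continuous) (v : HeightOneSpectrum (𝓞 ↥(maximalRealSubfield L))) :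
    (mq v).IsAdmissibleOn fun x => IsRegularElt (x.val : GL (Fin 3) (UnitaryGroup.LocalRing L v)) := by
  rw [hmq v]
  exact forall_isAdmissibleOn_isRegularElt_transport L H ψ hcorr' (fun v => (hcan v).isAdmissibleOn) v

/-! ### §3 (xii-d) at the transport family -/

/-- **(xii-d) AT A FAMILY `mq` THAT IS THE TRANSPORT FAMILY, every hypothesis discharged** — the form the kit reads with `mq := 𝔨.mq`,
`hmq := fun v => rfl`: inner form `U(H)` with local orbital measure families `mG v` CANONICAL on the regular classes for Haar measures `νG v`,
`νG v (U(H)(𝒪_v)) = 1`; local congruences `ψ_v : U(H)(L⁺_v) ≃ₜ* U(Φ₃)(L⁺_v)` with `ψ_v⁻¹ γ ↔ γ` and `ψ_v⁻¹ U(Φ₃)(𝒪_v) = U(H)(𝒪_v)` for `v ∉ S₀`;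
a normalised Haar measure `νq v` on `U(Φ₃)(L⁺_v)`; local families `mq v = (ψ_v)_* mG v` (`hmq`); an archimedean family `mqi` admissible on the regular
classes; `γ₀ ∈ U(H)(L⁺)` regular with rational correspondent `γ ∈ U(Φ₃)(L⁺)`; an `IsTest` pure tensor `T` on `U(Φ₃)(𝔸)`.  Then
`∃ S₁, ∀ S ⊇ S₁, IsEulerOnClasses 𝒞_𝐀(γ₀) (ofLocalAdelic mq mqi) T.eval S (v ↦ Φ^st_v(γ_v, T.loc v; mq v)) (Φ^st_∞(γ ⊗ 1, T.arch; mqi))` — ★ (E3c)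
with the [Kt₄] fact, admissibility, both normalisations and the integrability ALL discharged (★ `MatchingAdeleGEventuallyKConj_holds`,
★ `forall_isAdmissibleOn_isRegularElt_transport`, ★ (MQ) `exists_isNormalisedOff_transport_toAdelic` ∕ `forall_exists_isNormalisedOff_transport_matchingAdeleG`,
★ `MatchingAdeleG.integrable_descConj_out_of_mem_classes` over ★ `OrbitalMeasureFamily.ofLocalAdelic_admissible`).
[cite: Rogawski1990, §4.3 pp. 43–44; §5.4 (5.4.3) pp. 72–73; §14.2 (14.2.1) p. 232] [cite: Kottwitz1986, Prop. 7.1] [cite: Gelbart1975, §10 pp. 154–155] -/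
theorem MatchingAdeleG.exists_isEulerOnClasses_transport_of_eq
    (mG : ∀ v : HeightOneSpectrum (𝓞 ↥(maximalRealSubfield L)), OrbitalMeasureFamily ((UnitaryGroup.cmDatum L 3 H).Local v))
    (ψ : ∀ v : HeightOneSpectrum (𝓞 ↥(maximalRealSubfield L)), (UnitaryGroup.cmDatum L 3 H).Local v ≃ₜ*
      (UnitaryGroup.cmDatum L 3 (Matrix.of fun i j : Fin 3 => if i.val + j.val + 1 = 3 then (1 : L) else 0)).Local v)
    (hcorr' : ∀ v (x : (UnitaryGroup.cmDatum L 3 (Matrix.of fun i j : Fin 3 => if i.val + j.val + 1 = 3 then (1 : L) else 0)).Local v),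
      Corresponds (UnitaryGroup.conjLocal L (IsCMField.complexConj L) v) ((UnitaryGroup.adelicForm L 3 H).map (UnitaryGroup.adeleToLocal L v))
        ((UnitaryGroup.adelicForm L 3 (Matrix.of fun i j : Fin 3 => if i.val + j.val + 1 = 3 then (1 : L) else 0)).map (UnitaryGroup.adeleToLocal L v))
        ((ψ v).symm x) x)
    (S₀ : Finset (HeightOneSpectrum (𝓞 ↥(maximalRealSubfield L))))
    (hψK : ∀ v, v ∉ S₀ → ∀ g, ψ v g ∈ UnitaryGroup.cmLocalIntegralLevel L 3 (Matrix.of fun i j : Fin 3 => if i.val + j.val + 1 = 3 then (1 : L) else 0) v ↔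
      g ∈ UnitaryGroup.cmLocalIntegralLevel L 3 H v)
    (νG : ∀ v : HeightOneSpectrum (𝓞 ↥(maximalRealSubfield L)), Measure ((UnitaryGroup.cmDatum L 3 H).Local v))
    [∀ v, (νG v).IsHaarMeasure] [∀ v, (νG v).IsMulRightInvariant]
    (νq : ∀ v : HeightOneSpectrum (𝓞 ↥(maximalRealSubfield L)),
      Measure ((UnitaryGroup.cmDatum L 3 (Matrix.of fun i j : Fin 3 => if i.val + j.val + 1 = 3 then (1 : L) else 0)).Local v))
    [∀ v, (νq v).IsHaarMeasure] [∀ v, (νq v).IsMulRightInvariant]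
    (hK : ∀ v, νG v (UnitaryGroup.cmLocalIntegralLevel L 3 H v) = 1)
    (hKq : ∀ v, νq v (UnitaryGroup.cmLocalIntegralLevel L 3 (Matrix.of fun i j : Fin 3 => if i.val + j.val + 1 = 3 then (1 : L) else 0) v) = 1)
    (hcan : ∀ v, (mG v).IsCanonical (fun x => IsRegularElt (x.val : GL (Fin 3) (UnitaryGroup.LocalRing L v))) (νG v))
    (mq : ∀ v : HeightOneSpectrum (𝓞 ↥(maximalRealSubfield L)),
      OrbitalMeasureFamily ((UnitaryGroup.cmDatum L 3 (Matrix.of fun i j : Fin 3 => if i.val + j.val + 1 = 3 then (1 : L) else 0)).Local v))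
    (hmq : ∀ v, mq v = (mG v).transport (ψ v).toMulEquiv (ψ v).continuous (ψ v).symm.continuous)
    (mqi : OrbitalMeasureFamily (UnitaryGroup.arch (↥(maximalRealSubfield L)) L (IsCMField.complexConj L) 3
      (Matrix.of fun i j : Fin 3 => if i.val + j.val + 1 = 3 then (1 : L) else 0)))
    (hadmA : mqi.IsAdmissibleOn fun a => IsRegularElt (a.val : GL (Fin 3) (mixedEmbedding.mixedSpace L)))
    {γ₀ : (UnitaryGroup.cmDatum L 3 H).Rational} (hreg : IsRegularElt (γ₀.val : GL (Fin 3) L))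
    {γ : (UnitaryGroup.cmDatum L 3 (Matrix.of fun i j : Fin 3 => if i.val + j.val + 1 = 3 then (1 : L) else 0)).Rational}
    (hγ : Corresponds (cmConjRingHom L) H (Matrix.of fun i j : Fin 3 => if i.val + j.val + 1 = 3 then (1 : L) else 0) γ₀ γ)
    (T : UnitaryGroup.PureTensor L 3 (Matrix.of fun i j : Fin 3 => if i.val + j.val + 1 = 3 then (1 : L) else 0)) (hT : T.IsTest) :
    ∃ S₁ : Finset (HeightOneSpectrum (𝓞 ↥(maximalRealSubfield L))), ∀ S : Finset (HeightOneSpectrum (𝓞 ↥(maximalRealSubfield L))), S₁ ⊆ S →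
      IsEulerOnClasses (MatchingAdeleG.classes L H γ₀)
        (UnitaryGroup.OrbitalMeasureFamily.ofLocalAdelic L 3 (Matrix.of fun i j : Fin 3 => if i.val + j.val + 1 = 3 then (1 : L) else 0)
          mq mqi) T.eval S
        (fun v => localStableOrbitalIntegral L 3 (Matrix.of fun i j : Fin 3 => if i.val + j.val + 1 = 3 then (1 : L) else 0) v
          (mq v) (T.loc v)
          ((UnitaryGroup.cmDatum L 3 (Matrix.of fun i j : Fin 3 => if i.val + j.val + 1 = 3 then (1 : L) else 0)).toLocal v
            ((UnitaryGroup.cmDatum L 3 (Matrix.of fun i j : Fin 3 => if i.val + j.val + 1 = 3 then (1 : L) else 0)).toAdelic γ)))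
        (archStableOrbitalIntegral L 3 (Matrix.of fun i j : Fin 3 => if i.val + j.val + 1 = 3 then (1 : L) else 0) mqi T.arch
          (cmRationalToArch L 3 (Matrix.of fun i j : Fin 3 => if i.val + j.val + 1 = 3 then (1 : L) else 0) γ)) := by
  -- every fact about the transport family is moved onto the opaque `mq` along `hmq` (default heartbeats throughout)
  have hmq' : (fun v => (mG v).transport (ψ v).toMulEquiv (ψ v).continuous (ψ v).symm.continuous) = mq := (funext hmq).symm
  have hF : UnitaryGroup.CompactCoreCentralizerLevelAE L 3 (Matrix.of fun i j : Fin 3 => if i.val + j.val + 1 = 3 then (1 : L) else 0) :=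
    UnitaryGroup.compactCoreCentralizerLevelAE_of_hermitian L 3 (Matrix.of fun i j : Fin 3 => if i.val + j.val + 1 = 3 then (1 : L) else 0)
      (UnitaryGroup.antidiagOne_isHermitian L 3) (UnitaryGroup.isUnit_antidiagOne_det L 3).ne_zero
  have hnormγ : ∃ S₁ : Finset (HeightOneSpectrum (𝓞 ↥(maximalRealSubfield L))),
      UnitaryGroup.IsNormalisedOff L 3 (Matrix.of fun i j : Fin 3 => if i.val + j.val + 1 = 3 then (1 : L) else 0) mq
        ((UnitaryGroup.cmDatum L 3 (Matrix.of fun i j : Fin 3 => if i.val + j.val + 1 = 3 then (1 : L) else 0)).toAdelic γ) S₁ := by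
    rw [← hmq']
    exact UnitaryGroup.exists_isNormalisedOff_transport_toAdelic L H ψ hcorr' S₀ hψK νG νq hK hKq hcan hF hreg hγ
  have hnorm : ∀ p : MatchingAdeleG L H γ₀, ∃ S₁ : Finset (HeightOneSpectrum (𝓞 ↥(maximalRealSubfield L))),
      UnitaryGroup.IsNormalisedOff L 3 (Matrix.of fun i j : Fin 3 => if i.val + j.val + 1 = 3 then (1 : L) else 0) mq p.adele S₁ := by
    rw [← hmq']
    exact UnitaryGroup.forall_exists_isNormalisedOff_transport_matchingAdeleG L H ψ hcorr' S₀ hψK νG νq hK hKq hcan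
      (MatchingAdeleGEventuallyKConj_holds L H) hF hreg hγ
  have hadm := transport_isAdmissibleOn_isRegularElt_of_eq mG ψ hcorr' νG hcan mq hmq
  exact MatchingAdeleG.exists_isEulerOnClasses_ofLocalAdelic (MatchingAdeleGEventuallyKConj_holds L H) hreg hγ mq mqi hadm hadmA
    hnormγ hnorm T hT (MatchingAdeleG.integrable_descConj_ofLocalAdelic_of_mem_classes hreg hγ mq mqi hadm hadmA hnorm T hT)

/-- **(xii-d) AT THE TRANSPORT FAMILY `mq v := (ψ_v)_* mG v`, every hypothesis discharged** (the previous theorem at `mq := fun v =>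
(mG v).transport (ψ v).toMulEquiv …`, `hmq := fun _ => rfl`): conclusion = ★ (E3c)'s VERBATIM at that family.
[cite: Rogawski1990, §4.3 pp. 43–44; §5.4 (5.4.3) pp. 72–73; §14.2 (14.2.1) p. 232] [cite: Kottwitz1986, Prop. 7.1] [cite: Gelbart1975, §10 pp. 154–155] -/
theorem MatchingAdeleG.exists_isEulerOnClasses_transport
    (mG : ∀ v : HeightOneSpectrum (𝓞 ↥(maximalRealSubfield L)), OrbitalMeasureFamily ((UnitaryGroup.cmDatum L 3 H).Local v))
    (ψ : ∀ v : HeightOneSpectrum (𝓞 ↥(maximalRealSubfield L)), (UnitaryGroup.cmDatum L 3 H).Local v ≃ₜ*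
      (UnitaryGroup.cmDatum L 3 (Matrix.of fun i j : Fin 3 => if i.val + j.val + 1 = 3 then (1 : L) else 0)).Local v)
    (hcorr' : ∀ v (x : (UnitaryGroup.cmDatum L 3 (Matrix.of fun i j : Fin 3 => if i.val + j.val + 1 = 3 then (1 : L) else 0)).Local v),
      Corresponds (UnitaryGroup.conjLocal L (IsCMField.complexConj L) v) ((UnitaryGroup.adelicForm L 3 H).map (UnitaryGroup.adeleToLocal L v))
        ((UnitaryGroup.adelicForm L 3 (Matrix.of fun i j : Fin 3 => if i.val + j.val + 1 = 3 then (1 : L) else 0)).map (UnitaryGroup.adeleToLocal L v))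
        ((ψ v).symm x) x)
    (S₀ : Finset (HeightOneSpectrum (𝓞 ↥(maximalRealSubfield L))))
    (hψK : ∀ v, v ∉ S₀ → ∀ g, ψ v g ∈ UnitaryGroup.cmLocalIntegralLevel L 3 (Matrix.of fun i j : Fin 3 => if i.val + j.val + 1 = 3 then (1 : L) else 0) v ↔
      g ∈ UnitaryGroup.cmLocalIntegralLevel L 3 H v)
    (νG : ∀ v : HeightOneSpectrum (𝓞 ↥(maximalRealSubfield L)), Measure ((UnitaryGroup.cmDatum L 3 H).Local v))
    [∀ v, (νG v).IsHaarMeasure] [∀ v, (νG v).IsMulRightInvariant]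
    (νq : ∀ v : HeightOneSpectrum (𝓞 ↥(maximalRealSubfield L)),
      Measure ((UnitaryGroup.cmDatum L 3 (Matrix.of fun i j : Fin 3 => if i.val + j.val + 1 = 3 then (1 : L) else 0)).Local v))
    [∀ v, (νq v).IsHaarMeasure] [∀ v, (νq v).IsMulRightInvariant]
    (hK : ∀ v, νG v (UnitaryGroup.cmLocalIntegralLevel L 3 H v) = 1)
    (hKq : ∀ v, νq v (UnitaryGroup.cmLocalIntegralLevel L 3 (Matrix.of fun i j : Fin 3 => if i.val + j.val + 1 = 3 then (1 : L) else 0) v) = 1)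
    (hcan : ∀ v, (mG v).IsCanonical (fun x => IsRegularElt (x.val : GL (Fin 3) (UnitaryGroup.LocalRing L v))) (νG v))
    (mqi : OrbitalMeasureFamily (UnitaryGroup.arch (↥(maximalRealSubfield L)) L (IsCMField.complexConj L) 3
      (Matrix.of fun i j : Fin 3 => if i.val + j.val + 1 = 3 then (1 : L) else 0)))
    (hadmA : mqi.IsAdmissibleOn fun a => IsRegularElt (a.val : GL (Fin 3) (mixedEmbedding.mixedSpace L)))
    {γ₀ : (UnitaryGroup.cmDatum L 3 H).Rational} (hreg : IsRegularElt (γ₀.val : GL (Fin 3) L))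
    {γ : (UnitaryGroup.cmDatum L 3 (Matrix.of fun i j : Fin 3 => if i.val + j.val + 1 = 3 then (1 : L) else 0)).Rational}
    (hγ : Corresponds (cmConjRingHom L) H (Matrix.of fun i j : Fin 3 => if i.val + j.val + 1 = 3 then (1 : L) else 0) γ₀ γ)
    (T : UnitaryGroup.PureTensor L 3 (Matrix.of fun i j : Fin 3 => if i.val + j.val + 1 = 3 then (1 : L) else 0)) (hT : T.IsTest) :
    ∃ S₁ : Finset (HeightOneSpectrum (𝓞 ↥(maximalRealSubfield L))), ∀ S : Finset (HeightOneSpectrum (𝓞 ↥(maximalRealSubfield L))), S₁ ⊆ S →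
      IsEulerOnClasses (MatchingAdeleG.classes L H γ₀)
        (UnitaryGroup.OrbitalMeasureFamily.ofLocalAdelic L 3 (Matrix.of fun i j : Fin 3 => if i.val + j.val + 1 = 3 then (1 : L) else 0)
          (fun v => (mG v).transport (ψ v).toMulEquiv (ψ v).continuous (ψ v).symm.continuous) mqi) T.eval S
        (fun v => localStableOrbitalIntegral L 3 (Matrix.of fun i j : Fin 3 => if i.val + j.val + 1 = 3 then (1 : L) else 0) v
          ((mG v).transport (ψ v).toMulEquiv (ψ v).continuous (ψ v).symm.continuous) (T.loc v)
          ((UnitaryGroup.cmDatum L 3 (Matrix.of fun i j : Fin 3 => if i.val + j.val + 1 = 3 then (1 : L) else 0)).toLocal v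
            ((UnitaryGroup.cmDatum L 3 (Matrix.of fun i j : Fin 3 => if i.val + j.val + 1 = 3 then (1 : L) else 0)).toAdelic γ)))
        (archStableOrbitalIntegral L 3 (Matrix.of fun i j : Fin 3 => if i.val + j.val + 1 = 3 then (1 : L) else 0) mqi T.arch
          (cmRationalToArch L 3 (Matrix.of fun i j : Fin 3 => if i.val + j.val + 1 = 3 then (1 : L) else 0) γ)) :=
  MatchingAdeleG.exists_isEulerOnClasses_transport_of_eq mG ψ hcorr' S₀ hψK νG νq hK hKq hcan _ (fun _ => rfl) mqi hadmA hreg hγ T hT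

end Transport

end Literature.NumberTheory.Rogawski1990

end
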